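import Literature.RepresentationTheory.TwistedCoinvariants
import Mathlib.LinearAlgebra.Isomorphisms
import HarnessLib

/-!
# Crux `H413`, programme P2, N3 road (a) — JACQUET CHARTS ARE UNIQUE UP TO A UNIQUE EQUIVARIANT ISOMORPHISM
# (so the (S5) dictionary may be proved on ANY chart and transported to any other)

Cell hodgecm-mathlib (D-0151), FLOOR 0, crux item H413 = stmt-HodgeConjecture-24833, programme P2; N3 road (a), seat A-p12 (g17).  WHY: letter (a) of
★ `GelbartRogawski1991.thetaType_nonsplit_jacquetModule` is reduced (★ p834949 `F0P2oThetaTypeJacquetLetterAOfDictionary`) to ONE datum, a Jacquet chart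
`(π : 𝒮 ↠ S₁, ker π = Coinvariants.ker (ω_v| ∘ N.subtype), σ, π (ω_v(u·1) f) = σ u (π f))` together with a dictionary `(Tr, hTr)` identifying `σ` with
`μ_v(det ·) ⊗ ω¹`.  Several charts are in play — the abstract one of ★ p834408 `exists_chart_of_coinvariants_equiv` (`e ∘ [·]_N` for any identification `e`
of the coinvariants), the frame chart `φ₀ ∘ Ψ` of ★ p831955 ∕ F0P2-p01 (g8)'s `F0P2oYCoinvariantsChart.exists_chart_of_frame`, and whatever model the (S5)
hand prefers.  This file records, in pure linear algebra over any commutative ring, that the choice is immaterial: two charts with the same kernel differ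
by a UNIQUE linear isomorphism `θ` with `θ ∘ π₁ = π₂` (`exists_linearEquiv_comp_eq`, `linearMap_comp_eq_unique`), `θ` intertwines the descended actions
(`semiconj_of_laws`), hence the twisted coinvariants agree (`nonempty_twistedCoinv_equiv_of_charts`) and a dictionary for one chart IS a dictionary for
the other (`exists_dictionary_of_charts`).  [BernsteinZelevinsky1976 §2.30–2.33 (uniqueness of the Jacquet functor's values up to unique isomorphism);
MoeglinVignerasWaldspurger1987 Chap. 3 §IV.]

## References
* [BernsteinZelevinsky1976] I. N. Bernstein, A. V. Zelevinsky, *Representations of the group GL(n, F) …*, Russian Math. Surveys 31 (1976): §2.30–2.33.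
* [MoeglinVignerasWaldspurger1987] C. Mœglin, M.-F. Vignéras, J.-L. Waldspurger, *Correspondances de Howe sur un corps p-adique*, LNM 1291 (1987): Chap. 3 §IV.
-/

set_option autoImplicit false
set_option linter.dupNamespace false -- the mandated namespace repeats the single-problem summit's segment

noncomputable section

open Literature.RepresentationTheory Representation

namespace Summit.HodgeConjecture.HodgeConjecture.Cruxes.H413.F0P2oJacquetChartUniqueness

variable {k : Type*} [CommRing k] {H S S₁ S₂ S' : Type*} [Group H]
  [AddCommGroup S] [Module k S] [AddCommGroup S₁] [Module k S₁] [AddCommGroup S₂] [Module k S₂] [AddCommGroup S' ] [Module k S']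
  (π₁ : S →ₗ[k] S₁) (π₂ : S →ₗ[k] S₂) (h₁ : Function.Surjective π₁) (h₂ : Function.Surjective π₂)
  (hker : LinearMap.ker π₁ = LinearMap.ker π₂)

include h₁ h₂ hker in
/-- **two quotient charts with the same kernel differ by a linear isomorphism**: `∃ θ : S₁ ≃ₗ[k] S₂` with `θ (π₁ v) = π₂ v` (both are `S ⧸ ker`, Mathlib
`LinearMap.quotKerEquivOfSurjective`, `Submodule.quotEquivOfEq`). [cite: BernsteinZelevinsky1976, §2.30–2.33] -/
theorem exists_linearEquiv_comp_eq : ∃ θ : S₁ ≃ₗ[k] S₂, ∀ v : S, θ (π₁ v) = π₂ v :=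
  ⟨((LinearMap.quotKerEquivOfSurjective π₁ h₁).symm.trans (Submodule.quotEquivOfEq _ _ hker)).trans
      (LinearMap.quotKerEquivOfSurjective π₂ h₂), fun v => by
    rw [LinearEquiv.trans_apply, LinearEquiv.trans_apply, LinearMap.quotKerEquivOfSurjective_symm_apply]
    exact LinearMap.quotKerEquivOfSurjective_apply_mk π₂ h₂ v⟩

include h₁ in
/-- **uniqueness**: a linear map `θ'` with `θ' ∘ π₁ = π₂` is determined (`π₁` is onto). [cite: BernsteinZelevinsky1976, §2.30–2.33] -/
theorem linearMap_comp_eq_unique {θ θ' : S₁ →ₗ[k] S₂} (hθ : ∀ v : S, θ (π₁ v) = π₂ v) (hθ' : ∀ v : S, θ' (π₁ v) = π₂ v) : θ = θ' :=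
  LinearMap.ext fun s => by
    obtain ⟨v, rfl⟩ := h₁ s
    rw [hθ, hθ']

include h₁ in
/-- **the comparison isomorphism intertwines the descended actions**: if `π₁`, `π₂` carry one action `ρW` of `H` on `S` to `σ₁`, `σ₂` (the chart laws), then
`θ (σ₁ h s) = σ₂ h (θ s)` for every `θ` with `θ ∘ π₁ = π₂`. [cite: MoeglinVignerasWaldspurger1987, Chap. 3 §IV] -/
theorem semiconj_of_laws (ρW : Representation k H S) (σ₁ : Representation k H S₁) (σ₂ : Representation k H S₂)
    (hσ₁ : ∀ (h : H) (v : S), π₁ (ρW h v) = σ₁ h (π₁ v)) (hσ₂ : ∀ (h : H) (v : S), π₂ (ρW h v) = σ₂ h (π₂ v))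
    (θ : S₁ →ₗ[k] S₂) (hθ : ∀ v : S, θ (π₁ v) = π₂ v) (h : H) (s : S₁) : θ (σ₁ h s) = σ₂ h (θ s) := by
  obtain ⟨v, rfl⟩ := h₁ s
  rw [← hσ₁, hθ, hθ, hσ₂]

include h₁ h₂ hker in
/-- **the twisted coinvariants of two charts agree**: `Coinv σ₁ χ ≃ₗ[k] Coinv σ₂ χ` (★ `TwistedCoinv.mapEquiv` along the comparison isomorphism, scalar `1`).
[cite: MoeglinVignerasWaldspurger1987, Chap. 3 §IV] -/
theorem nonempty_twistedCoinv_equiv_of_charts (ρW : Representation k H S) (σ₁ : Representation k H S₁) (σ₂ : Representation k H S₂)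
    (hσ₁ : ∀ (h : H) (v : S), π₁ (ρW h v) = σ₁ h (π₁ v)) (hσ₂ : ∀ (h : H) (v : S), π₂ (ρW h v) = σ₂ h (π₂ v)) (χ : H →* kˣ) :
    Nonempty (TwistedCoinv.Coinv σ₁ χ ≃ₗ[k] TwistedCoinv.Coinv σ₂ χ) := by
  obtain ⟨θ, hθ⟩ := exists_linearEquiv_comp_eq π₁ π₂ h₁ h₂ hker
  exact ⟨TwistedCoinv.mapEquiv σ₁ χ σ₂ χ θ (fun _ => 1)
    (fun h s => by rw [Units.val_one, one_smul]; exact (semiconj_of_laws π₁ π₂ h₁ ρW σ₁ σ₂ hσ₁ hσ₂ θ.toLinearMap hθ h s).symm)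
    (fun h => by rw [one_mul])⟩

include h₁ h₂ hker in
/-- **a dictionary for one chart is a dictionary for every chart**: if `Tr₁ : S₁ ≃ₗ S'` carries `σ₁` to the scalar twist `c ⊗ ρ'`
(`ρ' u (Tr₁ s) = c u • Tr₁ (σ₁ u s)`), then `Tr₂ := θ⁻¹ ≫ Tr₁` does the same for `σ₂`. [cite: MoeglinVignerasWaldspurger1987, Chap. 3 §IV] -/
theorem exists_dictionary_of_charts (ρW : Representation k H S) (σ₁ : Representation k H S₁) (σ₂ : Representation k H S₂)
    (hσ₁ : ∀ (h : H) (v : S), π₁ (ρW h v) = σ₁ h (π₁ v)) (hσ₂ : ∀ (h : H) (v : S), π₂ (ρW h v) = σ₂ h (π₂ v))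
    (ρ' : Representation k H S') (c : H → kˣ) (Tr₁ : S₁ ≃ₗ[k] S') (hTr₁ : ∀ (u : H) (s : S₁), ρ' u (Tr₁ s) = ((c u : kˣ) : k) • Tr₁ (σ₁ u s)) :
    ∃ Tr₂ : S₂ ≃ₗ[k] S', (∀ (u : H) (s : S₂), ρ' u (Tr₂ s) = ((c u : kˣ) : k) • Tr₂ (σ₂ u s)) ∧ ∀ v : S, Tr₂ (π₂ v) = Tr₁ (π₁ v) := by
  obtain ⟨θ, hθ⟩ := exists_linearEquiv_comp_eq π₁ π₂ h₁ h₂ hker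
  have hθ' : ∀ (u : H) (s : S₂), θ.symm (σ₂ u s) = σ₁ u (θ.symm s) := fun u s => by
    rw [LinearEquiv.symm_apply_eq]
    have h := semiconj_of_laws π₁ π₂ h₁ ρW σ₁ σ₂ hσ₁ hσ₂ θ.toLinearMap hθ u (θ.symm s)
    rw [LinearEquiv.coe_toLinearMap, LinearEquiv.apply_symm_apply] at h
    exact h.symm
  refine ⟨θ.symm.trans Tr₁, fun u s => ?_, fun v => ?_⟩
  · rw [LinearEquiv.trans_apply, LinearEquiv.trans_apply, hTr₁, hθ']
  · rw [LinearEquiv.trans_apply, ← hθ, LinearEquiv.symm_apply_apply]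

end Summit.HodgeConjecture.HodgeConjecture.Cruxes.H413.F0P2oJacquetChartUniqueness

end
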